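import Summits.Ventures.PercRepro.ProfilePointedCircuitClassesPairSevenB

/-!
# PercRepro — THE PER-PAIR IN–OUT INEQUALITY AT `n = 12`, III: THE DEFICIENT DEMANDS' SIDE, THE DOUBLE COUNTING
AND THE TRANSFER (p5, gen 42; `proofs/P5-GM1.md` §64)

A deficient demand `W` sends at least `12`: its three disjoint units `B − p` (`p ∈ nonco(W)`) carry the common
weight `wt` (`pwt_erase_eq`), and when `3·wt < 12` — then `wt = 3` and `cw(W) ∖ S ≠ ∅` — the three clean units
`K + p + w` (`w ∈ cw(W) ∖ S`) add `3` (`twelve_le_sum_pwt_of_deficient`).  With the units' side of part I,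
`12·#𝒟 ≤ Σ_{W,U} pwt ≤ 12·#𝒰` (`card_pdem_le_card_punit`).  TRANSFER: for a matroid `N` with `#E = 12` and rank
`7`, `thru_5(S) = #𝒟` and `thru_6(S) = #𝒰` in the dual `N✶` (rank `5`; loopless when `N` is coloop-free), so
**`thru_5(S) ≤ thru_{n−6}(S)` for every pair `S` — `InOutPairBottomFive` at `ρ = 7`**
(`thruCount_five_le_thruCount_six_of_card_eq_twelve`; a coloop inside `S` kills `thru_5`, a coloop outside `S` is
deleted, `thruCount_bottom_le_thruCount_delete_of_coloop` + `thruCount_delete_le_thruCount_succ_of_coloop`).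
-/

open scoped Matroid

namespace PercRepro.Cogirth

open Finset ThmH Skew Shadow Profile

variable {α : Type} [DecidableEq α] {M : Matroid α} [M.Finite]

section PairSevenC

/-- **THE DEFICIENT DEMANDS' SIDE**: a deficient demand sends at least `12`. -/
theorem twelve_le_sum_pwt_of_deficient (hn : (gr M).card = 12) (hR : rk M (gr M) = 5)
    (hll : ∀ x ∈ gr M, rk M {x} = 1) {S : Finset α} (hS : S ⊆ gr M) (hS2 : S.card = 2) {W : Finset α}
    (hW : W ∈ pdem M S) (hd : deficient M W) : 12 ≤ ∑ U ∈ punit M S, pwt M S W U := by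
  obtain ⟨hWg, hW5, hSW, hWr, hWc⟩ := mem_pdem.1 hW
  obtain ⟨hc3, hr1⟩ := nonco_card_eq_three_of_deficient hn hll hW hd
  have hBg : gr M \ W ⊆ gr M := sdiff_subset
  have hncB : nonco M W ⊆ gr M \ W := filter_subset _ _
  have hncg : nonco M W ⊆ gr M := hncB.trans hBg
  obtain ⟨p₀, hp₀⟩ : (nonco M W).Nonempty := card_pos.1 (by omega)
  -- the three disjoint units `B − p` carry the common weight `wt`
  set wt : ℕ := (if (cw M W p₀).card = 1 ∧ cw M W p₀ ∩ S = ∅ then 3 else 12 / ((cw M W p₀ \ S).card + 1))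
    with hwt
  have hcw : ∀ p ∈ nonco M W, cw M W p = cw M W p₀ := fun p hp =>
    cw_eq_of_parallel hll hWg (hncg hp) (hncg hp₀) (rk_pair_le_one_of_mem_nonco hn hll hW hd hp hp₀)
  have hwtp : ∀ p ∈ nonco M W, pwt M S W ((gr M \ W).erase p) = wt := by
    intro p hp
    rw [pwt_erase_eq hW hp, hcw p hp]
  have hF₁ : (nonco M W).image (fun p => (gr M \ W).erase p) ⊆ punit M S := by
    rw [← filter_punit_inter_eq_image hn hR hW]
    exact filter_subset _ _
  have hinj₁ : Set.InjOn (fun p => (gr M \ W).erase p) (nonco M W) :=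
    fun p hp p' hp' h => (gr M \ W).erase_injOn (hncB (mem_coe.1 hp)) (hncB (mem_coe.1 hp')) h
  have hsum₁ : ∑ U ∈ (nonco M W).image (fun p => (gr M \ W).erase p), pwt M S W U = 3 * wt := by
    rw [sum_image hinj₁, sum_congr rfl hwtp, sum_const, hc3, smul_eq_mul]
  -- `wt ≥ 3`
  have hwt3 : 3 ≤ wt := by
    rw [← hwtp p₀ hp₀]
    have hU₀ : (gr M \ W).erase p₀ ∈ punit M S := hF₁ (mem_image_of_mem _ hp₀)
    exact three_le_pwt_of_inter_eq_empty hn hR hS hS2 hW hU₀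
      (disjoint_iff_inter_eq_empty.1 (disjoint_of_subset_right (erase_subset _ _) sdiff_disjoint.symm))
  rcases Nat.lt_or_ge (3 * wt) 12 with hlt | hge
  · -- `wt = 3`: the clean units are needed, and `cw(W) ∖ S` is nonempty
    have hm : (cw M W p₀ \ S).Nonempty := by
      rw [nonempty_iff_ne_empty]
      intro hemp
      rw [hwt] at hlt
      split_ifs at hlt with h20
      · have : cw M W p₀ \ S = cw M W p₀ := by
          rw [Finset.sdiff_eq_self_iff_disjoint, disjoint_iff_inter_eq_empty]
          exact h20.2
        rw [this] at hemp
        rw [hemp, card_empty] at h20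
        omega
      · rw [hemp, card_empty] at hlt
        norm_num at hlt
    obtain ⟨w, hw⟩ := hm
    have hwW : w ∈ W := by
      have := (mem_sdiff.1 hw).1
      unfold cw at this
      exact (mem_filter.1 this).1
    have hwB : w ∉ gr M \ W := fun h => (mem_sdiff.1 h).2 hwW
    have hcl : ∀ p ∈ nonco M W,
        insert w (insert p ((gr M \ W) \ nonco M W)) ∈ punit M S ∧
          pwt M S W (insert w (insert p ((gr M \ W) \ nonco M W))) = 1 := by
      intro p hp
      exact clean_unit_facts hn hR hll hW hd hp (by rw [hcw p hp]; exact hw)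
    have hF₂ : (nonco M W).image (fun p => insert w (insert p ((gr M \ W) \ nonco M W))) ⊆ punit M S := by
      intro V hV
      obtain ⟨p, hp, rfl⟩ := mem_image.1 hV
      exact (hcl p hp).1
    have hinj₂ : Set.InjOn (fun p => insert w (insert p ((gr M \ W) \ nonco M W))) (nonco M W) := by
      intro p hp p' hp' h
      simp only at h
      have hpW : p ∉ W := (mem_sdiff.1 (hncB (mem_coe.1 hp))).2
      have hpK : p ∉ (gr M \ W) \ nonco M W := fun h' => (mem_sdiff.1 h').2 (mem_coe.1 hp)
      have : p ∈ insert w (insert p' ((gr M \ W) \ nonco M W)) := by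
        rw [← h]; exact mem_insert_of_mem (mem_insert_self _ _)
      rw [mem_insert, mem_insert] at this
      rcases this with rfl | rfl | hK
      · exact absurd hwW hpW
      · rfl
      · exact absurd hK hpK
    have hsum₂ : ∑ U ∈ (nonco M W).image (fun p => insert w (insert p ((gr M \ W) \ nonco M W))),
        pwt M S W U = 3 := by
      rw [sum_image hinj₂, sum_congr rfl (fun p hp => (hcl p hp).2), sum_const, hc3, smul_eq_mul, mul_one]
    have hdisj : Disjoint ((nonco M W).image (fun p => (gr M \ W).erase p))
        ((nonco M W).image (fun p => insert w (insert p ((gr M \ W) \ nonco M W)))) := by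
      rw [disjoint_left]
      intro U hU₁ hU₂
      obtain ⟨p, _, rfl⟩ := mem_image.1 hU₁
      obtain ⟨p', _, hp'⟩ := mem_image.1 hU₂
      have : w ∈ (gr M \ W).erase p := by rw [← hp']; exact mem_insert_self _ _
      exact hwB (erase_subset _ _ this)
    calc 12 ≤ 3 * wt + 3 := by omega
      _ = ∑ U ∈ (nonco M W).image (fun p => (gr M \ W).erase p) ∪
            (nonco M W).image (fun p => insert w (insert p ((gr M \ W) \ nonco M W))), pwt M S W U := by
          rw [sum_union hdisj, hsum₁, hsum₂]
      _ ≤ ∑ U ∈ punit M S, pwt M S W U := sum_le_sum_of_subset (union_subset hF₁ hF₂)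
  · calc 12 ≤ 3 * wt := hge
      _ = ∑ U ∈ (nonco M W).image (fun p => (gr M \ W).erase p), pwt M S W U := hsum₁.symm
      _ ≤ ∑ U ∈ punit M S, pwt M S W U := sum_le_sum_of_subset hF₁

/-- **THE PER-PAIR INEQUALITY IN THE DUAL**: on a loopless matroid of rank `5` with `12` points, for every pair `S`,
the bases `W ⊇ S` with spanning complement are at most the spanning `6`-sets avoiding `S` with spanning complement
(`12·#𝒟 ≤ Σ pwt ≤ 12·#𝒰`). -/
theorem card_pdem_le_card_punit (hn : (gr M).card = 12) (hR : rk M (gr M) = 5) (hll : ∀ x ∈ gr M, rk M {x} = 1)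
    {S : Finset α} (hS : S ⊆ gr M) (hS2 : S.card = 2) : (pdem M S).card ≤ (punit M S).card := by
  have h1 : 12 * (pdem M S).card ≤ ∑ W ∈ pdem M S, ∑ U ∈ punit M S, pwt M S W U := by
    rw [mul_comm, ← smul_eq_mul]
    apply card_nsmul_le_sum
    intro W hW
    by_cases hd : deficient M W
    · exact twelve_le_sum_pwt_of_deficient hn hR hll hS hS2 hW hd
    · exact twelve_le_sum_pwt_of_not_deficient hn hR hS hS2 hW hd
  have h2 : ∑ W ∈ pdem M S, ∑ U ∈ punit M S, pwt M S W U ≤ 12 * (punit M S).card := by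
    rw [sum_comm, mul_comm, ← smul_eq_mul]
    apply sum_le_card_nsmul
    intro U hU
    exact sum_pwt_le_twelve hn hR hS hU
  omega

end PairSevenC

section PairSevenTransfer

variable {N : Matroid α} [N.Finite]

/-- **THE PER-PAIR IN–OUT INEQUALITY AT `n = 12` ON COLOOP-FREE GROUND SETS**: `#E = 12`, `ρ(E) = 7`, no coloops ⟹
`thru_5(S) ≤ thru_6(S)` for every pair `S ⊆ E` (the dual count `card_pdem_le_card_punit`). -/
theorem thruCount_five_le_thruCount_six_of_twelve_of_cf (hn : (gr N).card = 12) (hR7 : rk N (gr N) = 7)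
    (hcf : ∀ x ∈ gr N, rk N ((gr N).erase x) = rk N (gr N)) {S : Finset α} (hS : S ⊆ gr N) (hS2 : S.card = 2) :
    thruCount N 5 S ≤ thruCount N 6 S := by
  have hR : rk (N✶) (gr (N✶)) = 5 := by
    rw [gr_dual]
    have := rk_dual_add_rk (M := N)
    omega
  have hll : ∀ x ∈ gr (N✶), rk (N✶) {x} = 1 := by
    intro x hx
    rw [gr_dual] at hx
    have h := (rk_dual_eq_card_iff (singleton_subset_iff.2 hx)).2 (by
      rw [sdiff_singleton_eq_erase]; exact hcf x hx)
    rw [h, card_singleton]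
  have h12 : (gr (N✶)).card = 12 := by rw [gr_dual]; exact hn
  have hSd : S ⊆ gr (N✶) := by rw [gr_dual]; exact hS
  have hmain := card_pdem_le_card_punit h12 hR hll hSd hS2
  -- the demands are the bi-independent `5`-sets through `S`
  have eD : (biIndepSets N 5).filter (fun W => S ⊆ W) = pdem (N✶) S := by
    ext W
    rw [mem_filter, mem_biIndepSets, mem_pdem, gr_dual]
    constructor
    · rintro ⟨⟨hWg, hW5, hWr, hWc⟩, hSW⟩
      have h := (biIndep_iff_dual_spanning hWg).1 ⟨hWr, hWc⟩
      rw [hR] at h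
      exact ⟨hWg, hW5, hSW, h.1, h.2⟩
    · rintro ⟨hWg, hW5, hSW, h1, h2⟩
      have h := (biIndep_iff_dual_spanning hWg).2 (by rw [hR]; exact ⟨h1, h2⟩)
      exact ⟨⟨hWg, hW5, h.1, h.2⟩, hSW⟩
  -- the units are the complements of the bi-independent `6`-sets through `S`
  have eU : ((biIndepSets N 6).filter (fun U' => S ⊆ U')).card = (punit (N✶) S).card := by
    apply card_nbij' (fun U' => gr N \ U') (fun U => gr N \ U)
    · intro U' hU'
      rw [mem_coe, mem_filter, mem_biIndepSets] at hU'
      obtain ⟨⟨hU'g, hU'6, hU'r, hU'c⟩, hSU'⟩ := hU'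
      have h := (biIndep_iff_dual_spanning hU'g).1 ⟨hU'r, hU'c⟩
      rw [hR] at h
      rw [mem_coe, mem_punit, gr_dual]
      refine ⟨sdiff_subset, by rw [card_sdiff_of_subset hU'g, hn, hU'6], ?_, h.2, ?_⟩
      · exact disjoint_iff_inter_eq_empty.1 (disjoint_of_subset_right hSU' sdiff_disjoint)
      · rw [Finset.sdiff_sdiff_eq_self hU'g]; exact h.1
    · intro U hU
      rw [mem_coe, mem_punit, gr_dual] at hU
      obtain ⟨hUg, hU6, hUS, hUr, hUc⟩ := hU
      rw [mem_coe, mem_filter, mem_biIndepSets]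
      have hcg : gr N \ U ⊆ gr N := sdiff_subset
      have h := (biIndep_iff_dual_spanning hcg).2 (by
        rw [hR, Finset.sdiff_sdiff_eq_self hUg]; exact ⟨hUc, hUr⟩)
      refine ⟨⟨hcg, by rw [card_sdiff_of_subset hUg, hn, hU6], h.1, h.2⟩, ?_⟩
      intro s hs
      rw [mem_sdiff]
      refine ⟨hS hs, fun hsU => ?_⟩
      have : s ∈ U ∩ S := mem_inter.2 ⟨hsU, hs⟩
      rw [hUS] at this
      exact notMem_empty s this
    · intro U' hU'
      rw [mem_coe, mem_filter, mem_biIndepSets] at hU'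
      exact Finset.sdiff_sdiff_eq_self hU'.1.1
    · intro U hU
      rw [mem_coe, mem_punit] at hU
      rw [gr_dual] at hU
      exact Finset.sdiff_sdiff_eq_self hU.1
  unfold thruCount
  rw [eD, eU]
  exact hmain

/-- **`InOutPairBottomFive` AT `ρ = 7`**: on every matroid with `#E = 12` and `ρ(E) = 7`, for every pair `S ⊆ E`,
`thru_5(S) ≤ thru_{n−6}(S) = thru_6(S)` — a coloop inside `S` kills `thru_5`, a coloop outside `S` is deleted
(`thru_5^N ≤ thru_5^{N∖x} ≤ thru_6^N`), and the coloop-free case is the dual count. -/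
theorem thruCount_five_le_thruCount_six_of_card_eq_twelve (hn : (gr N).card = 12) (hR7 : rk N (gr N) = 7)
    {S : Finset α} (hS : S ⊆ gr N) (hS2 : S.card = 2) : thruCount N 5 S ≤ thruCount N ((gr N).card - 6) S := by
  have e6 : (gr N).card - 6 = 6 := by omega
  rw [e6]
  -- a coloop inside `S`
  by_cases hcs : ∃ s ∈ S, rk N ((gr N).erase s) < rk N (gr N)
  · obtain ⟨s, hs, hco⟩ := hcs
    have h0 := thruCount_bottom_eq_zero_of_coloop_mem hs hco
    have e5 : (gr N).card - rk N (gr N) = 5 := by omega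
    rw [e5] at h0
    rw [h0]
    exact Nat.zero_le _
  -- a coloop outside `S`
  by_cases hx : ∃ x ∈ gr N, rk N ((gr N).erase x) < rk N (gr N)
  · obtain ⟨x, hxg, hco⟩ := hx
    have h1 := thruCount_bottom_le_thruCount_delete_of_coloop (ν := 5) (by omega) hco S
    have h2 : thruCount (N ＼ ({x} : Set α)) 5 S ≤ thruCount N 6 S :=
      thruCount_delete_le_thruCount_succ_of_coloop 5 hxg hco S
    omega
  · have hcf : ∀ x ∈ gr N, rk N ((gr N).erase x) = rk N (gr N) := by
      intro x hxg
      have hle := rk_mono' (M := N) (erase_subset x (gr N))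
      have : ¬ rk N ((gr N).erase x) < rk N (gr N) := fun h => hx ⟨x, hxg, h⟩
      omega
    exact thruCount_five_le_thruCount_six_of_twelve_of_cf hn hR7 hcf hS hS2

end PairSevenTransfer

end PercRepro.Cogirth
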